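import Literature.MathematicalPhysics.QuantumFieldTheory.Balaban1983to89.Node00.CriticalOnFibre
import Literature.MathematicalPhysics.QuantumFieldTheory.Balaban1983to89.Node00.Record12BgRowTopDomain

/-!
# NODE 00 — ROW P11, TOP-DOMAIN (F7 ∕ `CoP`) CURRENCY: «minimal over print's class (6) ON A TOP DOMAIN ⇒ critical on the fibre», and [15] PROPOSITION 8
# p. 304 at a genuine step as the NAMED FACT `Prop8RegSepTopStep F N Sup B₃ a₀ a₁` the top-domain Theorem-1 sentence `VariationalThm1RegSepTop7` reduces to

Cell `pub-ymgap`, seat `pub-ymgap-dag-n07-e` generation 8 (R141 (C), DAG node N07 = [15]; INBOX INTENT-20d of 2026-08-27 ≈10:15Z).  NEW leaf; this seat's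
`Node00.CriticalOnFibre` (p514709 ∕ v1.1 p519305) and node00-def-P11's FILE 12a `Node00.Record12BgRowTopDomain` (p519236: `Sect2.omegaPlaqsTop`, `omegaBondsTop`,
`CoDivClassOnTop`, `printedPlaqsTop`, `DataSmall7PTop`) CONSUMED BY NAME, nothing modified.  `--kind definition --supports stmt-QuantumFields-20289`.

WHY.  After director-ym №160's F7 ∕ `CoP` edition the K0 row displays def-P11's `VariationalThm1RegSepTop7 F N Sup B₃ a₀ a₁` (FILE 12b; `…CoP7` = it at
`Sup := suppDomOfRecord`, FILE 12c, definitional): the class (6) and the conclusion (8) read the scale-0 members on a TOP DOMAIN `Ω₀ = Sup ν K s.Ω` instead of the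
whole torus.  The Prop-8 face of v1.1 (`Prop8RegSepStep`, whole-torus scale-0 members) must follow the record, or «N07's debt = [15] Prop. 8» is stated over a
superseded class.  This file is `CriticalOnFibre` §2–§4 with the Top objects substituted — nothing else changes: the Top class is again finitely many STRICT
inequalities between continuous functions of the bond matrices, so a minimiser over it is critical on the fibre (Fermat), and Prop. 8 (top-domain reading,
`k ≥ 1`, two-sided comparability) gives the Theorem-1 sentence by currying.

CONTENTS.  §1 `eventually_coDivClassOnTop`, `eventually_mem_classTop` (curve-openness), ★ `isCritOnFibre_of_isMinimizer_classTop`.  §2 ★★ `Prop8RegSepTopStep F N Sup B₃ a₀ a₁`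
(NAMED FACT, never asserted: [15] Prop. 8 p.304 at the objects of record, top-domain reading, `1 ≤ k`, C′), `Prop8RegSepTopStep.of_le`,
★ `regular_of_isMinimizer_classTop_of_prop8TopStep` (FILE 12b's sentence at a genuine step from Prop. 8; the `k = 0` step — flat unconstrained minimiser — is
supplied Summit-side, `…N07Thm1Top7FromProp8`).
READING displayed (unchanged): criticality in the CURVE form; print's Sect. F uses the (82) tangent form — GAP-STATED(submersion), ref-C READ-121 NOTE 2.  The support
`Sup` is a PARAMETER exactly as in FILE 12b (print's `Ω₀` is ONE admissible domain; consumers instantiate `Sup := suppDomOfRecord` only).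

HONEST FRAMING: one named fact (a `Prop`, never asserted) + kernel bookkeeping; nothing of Bałaban proved; N07 ∕ K0⁗ NOT discharged; counts unmoved (5∕27);
one finite T⁴ programme at fixed ε — NOT continuum ∕ ℝ⁴ ∕ OS ∕ mass gap ∕ Clay.  No `sorry`, no `instance`, no `notation`.
-/

noncomputable section

namespace Literature.MathematicalPhysics.QuantumFieldTheory.Balaban1983to89.Node00

open Filter Topology
open T4Continuum (T4Family)
open B15DeterminingSets
open scoped Matrix.Norms.L2Operator

/-! ## §1  Curve-openness of the top-domain class and «minimal ⇒ critical» over it -/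

section OpennessTop

variable {P : Params} {N : ℕ} [NeZero N]

/-- **CURVE-OPENNESS OF THE (1.9)-HALF ON A TOP DOMAIN** (def-P11's `Sect2.CoDivClassOnTop Ω Ω₀ k ε`): a map continuous at `x₀` with value satisfying it there
satisfies it near `x₀`. [cite: Balaban1985RegularSpaces, (1.9) p.77; Balaban1985Variational, (2),(6) p.278] -/
theorem eventually_coDivClassOnTop {X : Type*} [TopologicalSpace X] {Ω : ℕ → Set (Site P 0)} {Ω₀ : Set (Site P 0)} {k : ℕ} {ε : ℝ}
    {γ : X → GaugeField P 0 (SU N)} {x₀ : X} (hγ : ContinuousAt (fun x (b : PBond P 0) => γ x b) x₀)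
    (h : Sect2.CoDivClassOnTop Ω Ω₀ k ε (γ x₀)) : ∀ᶠ x in 𝓝 x₀, Sect2.CoDivClassOnTop Ω Ω₀ k ε (γ x) := by
  have hfin : ∀ i : Fin (k + 1), ∀ᶠ x in 𝓝 x₀, Sect2.CoDivSmallOn (Sect2.omegaBondsTop Ω Ω₀ (i : ℕ)) (ε * P.eta i ^ 3) (γ x) :=
    fun i => eventually_coDivSmallOn hγ (h i (Nat.lt_succ_iff.mp i.2))
  exact (eventually_all.2 hfin).mono fun x hx n hn => hx ⟨n, Nat.lt_succ_of_le hn⟩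

/-- **CURVE-OPENNESS OF PRINT'S CLASS (6) ON A TOP DOMAIN** (the literal of FILE 12b's `VariationalThm1RegSepTop7`: (1.7) on `omegaPlaqsTop`, any thresholds `r_n`, and
(1.9) `CoDivClassOnTop`). [cite: Balaban1985RegularSpaces, (1.7)–(1.9) p.77; Balaban1985Variational, (2),(6) p.278] -/
theorem eventually_mem_classTop {X : Type*} [TopologicalSpace X] {Ω : ℕ → Set (Site P 0)} {Ω₀ : Set (Site P 0)} {k : ℕ} {r : ℕ → ℝ} {ε : ℝ}
    {γ : X → GaugeField P 0 (SU N)} {x₀ : X} (hγ : ContinuousAt (fun x (b : PBond P 0) => γ x b) x₀)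
    (h : (∀ n, n ≤ k → PlaqSmallOn (Sect2.omegaPlaqsTop Ω Ω₀ n) (r n) (γ x₀)) ∧ Sect2.CoDivClassOnTop Ω Ω₀ k ε (γ x₀)) :
    ∀ᶠ x in 𝓝 x₀, (∀ n, n ≤ k → PlaqSmallOn (Sect2.omegaPlaqsTop Ω Ω₀ n) (r n) (γ x)) ∧ Sect2.CoDivClassOnTop Ω Ω₀ k ε (γ x) := by
  have hfin : ∀ i : Fin (k + 1), ∀ᶠ x in 𝓝 x₀, PlaqSmallOn (Sect2.omegaPlaqsTop Ω Ω₀ (i : ℕ)) (r i) (γ x) :=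
    fun i => eventually_plaqSmallOn hγ (h.1 i (Nat.lt_succ_iff.mp i.2))
  exact ((eventually_all.2 hfin).mono fun x hx n hn => hx ⟨n, Nat.lt_succ_of_le hn⟩).and (eventually_coDivClassOnTop hγ h.2)

end OpennessTop

section MinimalCriticalTop

variable {F : T4Family} {N : ℕ} [NeZero N]

/-- ★ **«MINIMAL ⇒ CRITICAL» OVER PRINT'S CLASS (6) ON A TOP DOMAIN** (FILE 12b's class literal, ANY thresholds and any top domain `Ω₀`): a minimiser of (2.12)
over it on the fibre of `W` is a critical configuration of (5) on that fibre — a curve through it differentiable at `0` is continuous there, stays in the OPEN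
class, and Fermat applies. [cite: Balaban1985Variational, (6) p.278, p.299 («minimal configuration»), Prop. 8 p.304; Balaban1985RegularSpaces, (1.7)–(1.9) p.77; Balaban1988Convergent, (2.12) p.256] -/
theorem isCritOnFibre_of_isMinimizer_classTop {K k : ℕ} {Ω : ℕ → Set (Site (F.P K) 0)} {Ω₀ : Set (Site (F.P K) 0)} {r : ℕ → ℝ} {ε : ℝ}
    {𝔹 : DetSet (F.P K)} {W : MSField (F.P K) (SU N)} {U₀ : GaugeField (F.P K) 0 (SU N)}
    (h : IsMinimizer (avOfRecord F N K)
      {U | (∀ n, n ≤ k → PlaqSmallOn (Sect2.omegaPlaqsTop Ω Ω₀ n) (r n) U) ∧ Sect2.CoDivClassOnTop Ω Ω₀ k ε U} 𝔹 W U₀) :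
    IsCritOnFibre F N K 𝔹 W U₀ := by
  intro γ h0 hd hc a ha
  have hγ : ContinuousAt (fun t (b : PBond (F.P K) 0) => γ t b) 0 := continuousAt_of_differentiableAt_val hd
  have hU : (∀ n, n ≤ k → PlaqSmallOn (Sect2.omegaPlaqsTop Ω Ω₀ n) (r n) (γ 0)) ∧ Sect2.CoDivClassOnTop Ω Ω₀ k ε (γ 0) := by
    rw [h0]
    exact h.1
  exact deriv_wilsonAction4_eq_zero_of_isMinimizer h h0 (eventually_mem_classTop hγ hU) hc ha

end MinimalCriticalTop

/-! ## §2  ★★ [15] Proposition 8 p. 304 at a genuine step, TOP-DOMAIN reading — the named fact — and the top-domain Theorem-1 sentence it yields -/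

section NamedFactProp8Top

variable (F : T4Family) (N : ℕ) [NeZero N]

/-- ★★ **[15] PROPOSITION 8 (p. 304 [28]), AT THE OBJECTS OF RECORD, AT A GENUINE STEP `k ≥ 1`, ON A TOP DOMAIN `Ω₀ = Sup ν K s.Ω`** — *«if U is a critical
configuration of (5) in the space (6) with V satisfying (7), and if ε₀ ≦ a₅, then U belongs to the space (8)»* —, in the binder block of def-P11's FILE 12b
`VariationalThm1RegSepTop7` (separated (2.18) index; thresholds `0 < δ_n ≤ a₁`, `B₃δ_n ≤ ε₀ ≤ a₀`, comparable BOTH ways; data with print's (7) on the concord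
range, scale 0 read on the printed plaquettes MEETING `Ω₀` — `Sect2.DataSmall7PTop`), with the binder `1 ≤ k` (this seat's LOCATED-M5: the tree's `k = 0` fibre is
unconstrained) and the minimiser hypothesis replaced by «`U` in the class (6) at `ε₀` ON `Ω₀` — (1.7) on `omegaPlaqsTop`, (1.9) `CoDivClassOnTop` —, on the fibre
of `W`, CRITICAL for (5) on that fibre (`IsCritOnFibre`)»: then `U` lies in (8) on `Ω₀` — (1.7) at `B₃δ_n·η_n²` on `omegaPlaqsTop`, (1.9) at `B₃δ_n·η_n³` on
`omegaBondsTop`.  A `Prop`, NEVER asserted; constants as parameters; the support selector `Sup` is a PARAMETER exactly as in FILE 12b (consumers instantiate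
`Sup := suppDomOfRecord`; print's `Ω₀` is one admissible domain, [15] (1) p.277), and with the ONE binder `0 < ν.M₁` right after the separation
hypothesis (print: `M₁` is a positive integer, [6] (1.3)–(1.6); at `M₁ = 0` the support selector of record is EMPTY and every scale-0 clause is vacuous —
node00-def-P11 g3 LOCATED-P11-EMPTY-SUPPORT, the same degenerate-instance class as this seat's LOCATED-M4∕M5; the binder is FILE 12d's `…Top7M` binder).
READING displayed: criticality in the CURVE form; print's Sect. F uses the (82) tangent form (GAP-STATED(submersion), ref-C READ-121 NOTE 2).
-- TODO(general form): ONE threshold ε₁ in print; general admissible `{Ω_j}` ∕ `𝔅_k` of [6] Sect. A and print's `Ω₀` with `dist(Ω₀ᶜ, Ω₁) > RM₁`.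
[cite: Balaban1985Variational, (1) p.277, Prop. 8 p.304, (2)–(8) pp.278–279, Sect. F pp.300–304; Balaban1985RegularSpaces, (1.3)–(1.9) p.77; Balaban1988Convergent, p.255, (2.6)–(2.8) pp.255–256, (2.10)–(2.12) p.256] -/
def Prop8RegSepTopStep (Sup : (ν : Stage7Numerics) → (K : ℕ) → (ℕ → Set (Site (F.P K) 0)) → Set (Site (F.P K) 0)) (B₃ a₀ a₁ : ℝ) : Prop :=
  ∀ (ν : Stage7Numerics) (M : ℕ) (g : ℕ → ℝ) (K k : ℕ) (s : SeqOfRecord F ν M g K k), Sect2.SeqSeparated ν.M₁ s → 0 < ν.M₁ → 1 ≤ k →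
    ∀ (ε₀ : ℝ) (δ : ℕ → ℝ),
    (∀ n, n ≤ k → 0 < δ n ∧ δ n ≤ a₁ ∧ B₃ * δ n ≤ ε₀) → (∀ n, n < k → δ n ≤ 2 * δ (n + 1)) → (∀ n, n < k → δ (n + 1) ≤ 2 * δ n) → ε₀ ≤ a₀ →
    ∀ W : MSField (F.P K) (SU N), Sect2.DataSmall7PTop (avOfRecord F N K) s.Ω (Sup ν K s.Ω) k δ W →
      ∀ U : GaugeField (F.P K) 0 (SU N),
        (∀ n, n ≤ k → PlaqSmallOn (Sect2.omegaPlaqsTop s.Ω (Sup ν K s.Ω) n) (ε₀ * (F.P K).eta n ^ 2) U) →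
        Sect2.CoDivClassOnTop s.Ω (Sup ν K s.Ω) k ε₀ U → AgreeOn (genSet s.Ω k) (avgFamily (avOfRecord F N K) U) W →
        IsCritOnFibre F N K (genSet s.Ω k) W U →
        (∀ n, n ≤ k → PlaqSmallOn (Sect2.omegaPlaqsTop s.Ω (Sup ν K s.Ω) n) (B₃ * δ n * (F.P K).eta n ^ 2) U) ∧
          ∀ n, n ≤ k → Sect2.CoDivSmallOn (Sect2.omegaBondsTop s.Ω (Sup ν K s.Ω) n) (B₃ * δ n * (F.P K).eta n ^ 3) U

variable {F N}

/-- The top-domain step fact is antitone in the ceilings `a₀`, `a₁`. [cite: Balaban1985Variational, Prop. 8 p.304 (bookkeeping)] -/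
theorem Prop8RegSepTopStep.of_le {Sup : (ν : Stage7Numerics) → (K : ℕ) → (ℕ → Set (Site (F.P K) 0)) → Set (Site (F.P K) 0)} {B₃ a₀ a₀' a₁ a₁' : ℝ}
    (h : Prop8RegSepTopStep F N Sup B₃ a₀ a₁) (ha₀ : a₀' ≤ a₀) (ha₁ : a₁' ≤ a₁) : Prop8RegSepTopStep F N Sup B₃ a₀' a₁' :=
  fun ν M g K k s hsep hM₁ hk ε₀ δ hδ hcomp hcomp' hε₀ W h7 U h17 h19 hfib hcrit =>
    h ν M g K k s hsep hM₁ hk ε₀ δ (fun n hn => ⟨(hδ n hn).1, (hδ n hn).2.1.trans ha₁, (hδ n hn).2.2⟩) hcomp hcomp' (hε₀.trans ha₀) W h7 U h17 h19 hfib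
      hcrit

/-- ★ **FILE 12b's TOP-DOMAIN THEOREM-1 SENTENCE AT A GENUINE STEP FROM PROPOSITION 8 (top-domain step form)**: for `k ≥ 1`, a separated index, thresholds
comparable both ways, `0 < M₁`, a datum with print's (7) (scale 0 on `Ω₀`), every minimiser of (2.12) over print's class (6) ON `Ω₀` at `ε₀` on the fibre of `W` lies in (8) on
`Ω₀` — minimal over the open class ⇒ critical on the fibre (§1) ⇒ Prop. 8.  (The `k = 0` case of `VariationalThm1RegSepTop7` is the flat unconstrained minimiser;
Summit-side.) [cite: Balaban1985Variational, Thm 1 (6)–(8) pp.278–279, p.299, Prop. 8 p.304; Balaban1988Convergent, (2.6)–(2.8) pp.255–256, (2.12) p.256] -/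
theorem regular_of_isMinimizer_classTop_of_prop8TopStep {Sup : (ν : Stage7Numerics) → (K : ℕ) → (ℕ → Set (Site (F.P K) 0)) → Set (Site (F.P K) 0)}
    {B₃ a₀ a₁ : ℝ} (h8 : Prop8RegSepTopStep F N Sup B₃ a₀ a₁) (ν : Stage7Numerics) (M : ℕ)
    (g : ℕ → ℝ) (K k : ℕ) (s : SeqOfRecord F ν M g K k) (hsep : Sect2.SeqSeparated ν.M₁ s) (hM₁ : 0 < ν.M₁) (hk : 1 ≤ k) (ε₀ : ℝ)
    (δ : ℕ → ℝ) (hδ : ∀ n, n ≤ k → 0 < δ n ∧ δ n ≤ a₁ ∧ B₃ * δ n ≤ ε₀) (hcomp : ∀ n, n < k → δ n ≤ 2 * δ (n + 1))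
    (hcomp' : ∀ n, n < k → δ (n + 1) ≤ 2 * δ n) (hε₀ : ε₀ ≤ a₀)
    (W : MSField (F.P K) (SU N)) (h7 : Sect2.DataSmall7PTop (avOfRecord F N K) s.Ω (Sup ν K s.Ω) k δ W) {U₀ : GaugeField (F.P K) 0 (SU N)}
    (hU₀ : IsMinimizer (avOfRecord F N K)
      {U | (∀ n, n ≤ k → PlaqSmallOn (Sect2.omegaPlaqsTop s.Ω (Sup ν K s.Ω) n) (ε₀ * (F.P K).eta n ^ 2) U) ∧
        Sect2.CoDivClassOnTop s.Ω (Sup ν K s.Ω) k ε₀ U} (genSet s.Ω k) W U₀) :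
    (∀ n, n ≤ k → PlaqSmallOn (Sect2.omegaPlaqsTop s.Ω (Sup ν K s.Ω) n) (B₃ * δ n * (F.P K).eta n ^ 2) U₀) ∧
      ∀ n, n ≤ k → Sect2.CoDivSmallOn (Sect2.omegaBondsTop s.Ω (Sup ν K s.Ω) n) (B₃ * δ n * (F.P K).eta n ^ 3) U₀ :=
  h8 ν M g K k s hsep hM₁ hk ε₀ δ hδ hcomp hcomp' hε₀ W h7 U₀ hU₀.1.1 hU₀.1.2 hU₀.2.1 (isCritOnFibre_of_isMinimizer_classTop hU₀)

end NamedFactProp8Top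

end Literature.MathematicalPhysics.QuantumFieldTheory.Balaban1983to89.Node00

end
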